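import Summits.HodgeConjecture.CorCM.HypDel.ExtAmbientReceptacleImageStable
import HarnessLib

/-!
# τ0-T3 (3/4) — S3 second layer, first half: `LevelForm`, the four S3 statements, `levelFormExists_of_leaves`, `pointAction_holds`

Cell `hodgecm-mathlib`, crux `HDel` (stmt-HodgeConjecture-24835), fan B / B-plan2 (T3 pen), KEY `t3-tau0-ext-receptacle-port` (B-p19 g5).
τ0-T3 RELOCATES, VERBATIM, the vocabulary and the kernel-checked reductions of the planning workfile
`Summits/HodgeConjecture/HodgeConjecture/Cruxes/HDel/Lines/F1ExtHodgeType.lean` v3b (sha16 2a4912bcb51bc6f9; B-plan2 g2–g4) into IMPORTABLE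
Summits modules (namespace `Summit.HodgeConjecture.CorCM.HypDel.ExtReceptacle`; split in four files by the gate's 400-line rule, workfile order kept:
`ExtAmbientReceptacle` §1–§2 · `ExtAmbientReceptacleImageStable` §3 · `ExtAmbientReceptacleLevelForm` §3b first half ·
`ExtAmbientReceptacleHDel` §3b second half + head + §5 + §7), so that v4's stubs, their leaf closers and the final by-name `HDel` closer can
`import` these names (a Cruxes workfile is not importable by Theorems files — the τ0 / T4 lesson, ★ p633409).  Statements, binders and proofs
are byte-identical to v3b; relocation edits only (the workfile's one open stub, its consumer and the skeleton head are NOT carried; the six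
closed `stub_*` theorems are renamed `*_holds`; the v2 census §6 is dropped).  NOTHING NEW IS ASSERTED; 0 `sorry`.
STATEMENT CONVENTIONS (unchanged): every binder block is the binder block of `Aux.canonicalModel_exists_ext_printed` VERBATIM (B-typ04 ★ p608274),
and `ReciprocityThrough` is the body of `Aux.IsCanonicalDescentAtExt` VERBATIM with the form `(N.obj K, e.inv.app K)` replaced by a receptacle
`(A, ι)`; no new Literature notion, no instance, no notation.

THIS FILE (3/4): §3b first half (workfile :407–:628) — `pointsOfForm_symm_map_baseChange_map`, `reciprocityThrough_of_comp`, the posited object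
`LevelForm`, the statements `LevelFormExists` / `PointAction` / `TransitionDescends` / `TranslationDescends`, and the proofs
`levelFormExists_of_leaves` (O1 ★ p625501, Z1, G1), `pointAction_holds`.  The `section S3SecondLayer` is closed here and re-opened in (4/4).
HC_CM is proved only modulo the 7 printed citations until rung 0 closes; nothing in this file is a proof of I-1′ or of `HDel`.
[cite: Deligne1971TravauxShimura, Cor. 5.7 p. 156, Exemple 5.8 and Variante 5.9 p. 157, Prop. 1.15 p. 132, 5.2 p. 155, Thm. 4.21 p. 152]
[cite: Deligne1979ShimuraVarieties, Criterion 2.3.1 and 2.2.5 (PDF p. 29), Prop. 2.3.10 (PDF p. 32) of Milne's translation]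
[cite: MumfordFogartyKirwan1994, Ch. 7 §3 Thm. 7.9] [cite: Shimura1998, §18.6 Thm. 18.6] [cite: Milne2005ShimuraVarieties, Def. 12.8 (62) p. 114, §13 p. 117, §14 pp. 126–127]
-/

open Function MulAction Topology NumberField IsDedekindDomain CategoryTheory CategoryTheory.Limits Matrix
  AlgebraicGeometry
open scoped Matrix ComplexOrder
open Literature.AlgebraicGeometry Literature.AlgebraicGeometry.Motives
open Literature.NumberTheory.Automorphic Literature.NumberTheory.Automorphic.UnitaryGroup
open Literature.NumberTheory.Automorphic.Liu2021.AppendixC (C5.OpenCompactSubgroup C5.SmallLevel)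
open Literature.Geometry.ComplexHyperbolic Literature.Geometry.ComplexHyperbolic.BallModel
open Literature.NumberTheory.Automorphic.ShimuraDissection
open Literature.AlgebraicGeometry.ShimuraVarieties Literature.AlgebraicGeometry.ShimuraVarieties.UnitaryCanonicalModel
open Literature.AlgebraicGeometry.ShimuraVarieties.UnitaryCanonicalModel.Aux
open Literature.NumberTheory.ComplexMultiplication (traceField reflexNormFiniteIdele)
open Literature.NumberTheory.AdelicBaseChange (finiteIdeleRelNorm)

namespace Summit.HodgeConjecture.CorCM.HypDel.ExtReceptacle

/-! ### §3b. S3 SECOND LAYER (v3): `ClosureDescent` ⇐ LEVELWISE OBJECT DESCENT (O1) + TRANSPORT OF (62) + LEVELWISE MORPHISM DESCENT (T1) + TOWER ASSEMBLY (ASM)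

[Deligne 1971] Cor. 5.7 / [Milne 2005] Thm. 13.7 (b) for the TOWER, cut into its four printed moves.  ONE posited object — an `E`-FORM OF ONE
LEVEL inside its receptacle (`LevelForm`: `N_K ↪ A` closed over `E` with `N_K ⊗_E ℂ ≅ Sh_{K×L₀}(G̃_M, X̃_M)_ℂ` compatibly with `ι`) — and four
statements over existing declarations: `LevelFormExists` (S3a: the closure of the `Aut(ℂ/E)`-stable image is defined over `E` — B-p06 ★ p625501
`GaloisDescent.exists_iso_bcFunctor_map_eq_of_isReduced_of_image_subset_complex`, fed by (G1)+(Z1) exactly as in §3; PROVED below),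
`PointAction` (S3c: reciprocity (62) read through `ι = e⁻¹ ≫ j_ℂ` transports to the `E`-structure of `N_K` — `AlgPoints.map_smul` ★,
`AlgPoints.map_injective_of_mono` ★, naturality of `pointsOfForm` (N1, six lines); PROVED below), `TransitionDescends` / `TranslationDescends`
(S3b: the transition maps and the class-group translations, which commute with `Aut(ℂ/E)` on the DENSE special pairs by (62) at two levels, are
defined over `E` — [Milne 2005] Prop. 13.1 in its dense form = generic leaf (T1) `GaloisDescent.existsUnique_map_eq_of_dense_complex` (A-p13 g9,
announced cell STATUS 10:49:24Z) + B-typ03 ★ p626711 `Aux.map_complexSystemExt_map_summandPointExt` / `map_translMorExt_summandPointExt`), and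
the kernel-checked composition `closureDescent_of_leaves` through A-p06 ★ p627312 `Motives.exists_functor_action_iso_of_levelwise'` (faithful-functor
tower descent: functor, descended class-group action, comparison and the levelwise reciprocity carried along verbatim; uniqueness of descended
morphisms = faithfulness of `Motives.baseChange ↥E ℂ`).
[cite: Deligne1971TravauxShimura, Cor. 5.7 p. 156, Variante 5.9 p. 157] [cite: Milne2005ShimuraVarieties, Prop. 13.1 p. 117, Thm. 13.7 p. 120] -/

section S3SecondLayer

section LevelForm

variable {L : Type} [Field L] [NumberField L] [IsCMField L]
variable {H : Matrix (Fin 3) (Fin 3) L} {τ : L →+* ℂ} {T : GL (Fin 3) ℂ}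
  {hT : formCongr (starRingEnd ℂ) T (H.map τ) = BallModel.J}
  {K₀ : C5.OpenCompactSubgroup ↥(finAdelic (↥(maximalRealSubfield L)) L (IsCMField.complexConj L) 3 H)}
variable (M : Type) [Field M] [NumberField M] [IsCMField M]

/-- (N1) **`pointsOfForm` is natural in the `E`-scheme**: for an `E`-morphism `j : N ⟶ A` and a complex point `Q` of `N ⊗_E ℂ`, the point
`j_ℂ(Q)` read in `A(ℂ)` is `j` applied to `Q` read in `N(ℂ)` (naturality of the first projection, ★ `baseChangeHom_map_left_comp_fst`).
[cite: Milne2005ShimuraVarieties, §13 p. 117] -/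
theorem pointsOfForm_symm_map_baseChange_map {E : IntermediateField ℚ ℂ} {N A : SchemeOver ↥E} (j : N ⟶ A)
    (Q : ComplexPoints ((Motives.baseChange ↥E ℂ).obj N)) :
    (pointsOfForm A).symm (AlgPoints.map ((Motives.baseChange ↥E ℂ).map j) Q) = AlgPoints.map j ((pointsOfForm N).symm Q) := by
  apply Over.OverMorphism.ext
  change ((AlgPoints.baseChangeEquiv (algebraMap ↥E ℂ) A).symm
      (AlgPoints.map ((baseChangeHom (algebraMap ↥E ℂ)).map j) Q)).left =
    (AlgPoints.map j ((AlgPoints.baseChangeEquiv (algebraMap ↥E ℂ) N).symm Q)).left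
  rw [AlgPoints.baseChangeEquiv_symm_apply_left, AlgPoints.map, AlgPoints.map, Over.comp_left, Over.comp_left,
    AlgPoints.baseChangeEquiv_symm_apply_left, Category.assoc]
  erw [Category.assoc, baseChangeHom_map_left_comp_fst]
  rfl

/-- **(62) transports along a monomorphism of `E`-schemes**: if reciprocity at the diagonal special pairs holds through `ι₀ ≫ j_ℂ` into `A`,
with `j : N ⟶ A` a monomorphism on underlying schemes (e.g. a closed immersion), then it holds through `ι₀` into `N`
(`AlgPoints.map_smul` + `AlgPoints.map_injective_of_mono` + (N1)). [cite: Milne2005ShimuraVarieties, §13 p. 117 (transport of structure)] -/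
theorem reciprocityThrough_of_comp (Φ : CMType M) (E : IntermediateField ℚ ℂ) [FiniteDimensional ℚ ↥E] (hE : ∀ x : L, τ x ∈ E)
    (L₀ : C5.OpenCompactSubgroup ↥(torusFinAdelic M)) (Sc : ComplexRecordSystem L H τ T hT K₀) (K : C5.SmallLevel K₀)
    {N A : SchemeOver ↥E} (j : N ⟶ A) [Mono j.left] (ι₀ : (complexSystemExt M Sc L₀).obj K ⟶ (Motives.baseChange ↥E ℂ).obj N)
    (h : ReciprocityThrough M Φ E hE L₀ Sc K A (ι₀ ≫ (Motives.baseChange ↥E ℂ).map j)) :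
    ReciprocityThrough M Φ E hE L₀ Sc K N ι₀ := by
  intro σ s hs v₃ x hx d hd t ht a p
  have h1 := h σ s hs v₃ x hx d hd t ht a p
  rw [AlgPoints.map_comp_apply, AlgPoints.map_comp_apply, pointsOfForm_symm_map_baseChange_map,
    pointsOfForm_symm_map_baseChange_map, ← AlgPoints.map_smul] at h1
  exact AlgPoints.map_injective_of_mono j h1

/-- **THE POSITED OBJECT OF S3 (interface): an `E`-FORM OF THE LEVEL `K` INSIDE ITS RECEPTACLE** — a closed `E`-subscheme `j : N ↪ A` of the
receptacle with an identification `e : N ⊗_E ℂ ≅ Sh_{K×L₀}(G̃_M, X̃_M)_ℂ` under which `ι` is `j_ℂ` (`e⁻¹ ≫ j_ℂ = ι`): [Deligne 1971] Cor. 5.7's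
«`Y = Y₀ ⊗_E ℂ` pour un sous-schéma fermé `Y₀ ⊂ X₀`» at one level.  Existence is the separate statement `LevelFormExists` (PROVED below from
(O1)); nothing is smuggled in.  Orientation of `e` = that of ★ `Motives.exists_functor_action_iso_of_levelwise'` (`G.obj (N₀ c) ≅ F.obj c`).
[cite: Deligne1971TravauxShimura, Cor. 5.7 p. 156] [cite: Milne2005ShimuraVarieties, Thm. 13.7 (b) p. 120] -/
structure LevelForm (Φ : CMType M) (E : IntermediateField ℚ ℂ) [FiniteDimensional ℚ ↥E] (hE : ∀ x : L, τ x ∈ E)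
    (L₀ : C5.OpenCompactSubgroup ↥(torusFinAdelic M)) (Sc : ComplexRecordSystem L H τ T hT K₀) (K : C5.SmallLevel K₀)
    (R : AmbientReceptacle M Φ E hE L₀ Sc K) where
  /-- the `E`-form of the level -/
  N : SchemeOver ↥E
  /-- its closed embedding into the receptacle, over `E` … -/
  j : N ⟶ R.A
  isClosedImmersion : IsClosedImmersion j.left
  /-- the comparison `N ⊗_E ℂ ≅ Sh_{K×L₀}(G̃_M, X̃_M)_ℂ` … -/
  e : (Motives.baseChange ↥E ℂ).obj N ≅ (complexSystemExt M Sc L₀).obj K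
  /-- … under which `ι = e⁻¹ ≫ j_ℂ`. -/
  fac : e.inv ≫ (Motives.baseChange ↥E ℂ).map j = R.ι

end LevelForm

/-- **S3a — THE CLOSURE OF THE IMAGE IS DEFINED OVER `E`** ([Deligne 1971] Cor. 5.7, first half): for every receptacle `(A, ι)` whose image is
`Aut(ℂ/E)`-stable on complex points (S5, a theorem of §3), the (reduced, closed) image of `ι` is `N ⊗_E ℂ` for a closed `E`-subscheme `N ↪ A` —
a `LevelForm`.  PROVED below (`levelFormExists_of_leaves`) from B-p06 ★ p625501 + (G1) + (Z1).
[cite: Deligne1971TravauxShimura, Cor. 5.7 p. 156] [cite: Milne2005ShimuraVarieties, Prop. 13.1, Cor. 13.2 p. 117; Milne AG Thm. 16.9] -/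
def LevelFormExists : Prop :=
  ∀ (L : Type) [Field L] [NumberField L] [IsCMField L] (H : Matrix (Fin 3) (Fin 3) L) (τ : L →+* ℂ)
    (T : GL (Fin 3) ℂ) (hT : formCongr (starRingEnd ℂ) T (H.map τ) = BallModel.J),
    (∀ τ' : L →+* ℂ, InfinitePlace.mk τ' ≠ InfinitePlace.mk τ → (H.map τ').PosDef) →
    (∀ v : Fin 3 → L, ShimuraVarieties.hermForm (cmConjRingHom L) H v v = 0 → v = 0) →
    ∀ K₀ : C5.OpenCompactSubgroup ↥(finAdelic (↥(maximalRealSubfield L)) L (IsCMField.complexConj L) 3 H),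
      (∀ g : finAdelic (↥(maximalRealSubfield L)) L (IsCMField.complexConj L) 3 H,
        ∀ γ ∈ arithmeticLevel (↥(maximalRealSubfield L)) L (IsCMField.complexConj L) 3 H
          (K₀.1.map (MulAut.conj g).toMonoidHom), IsOfFinOrder γ → γ = 1) →
        ∀ (Sc : ComplexRecordSystem L H τ T hT K₀) (M : Type) [Field M] [NumberField M] [IsCMField M] (j : L →+* M)
          (Φ : CMType M), IsExtAdapted τ j Φ →
          ∀ (E : IntermediateField ℚ ℂ) [FiniteDimensional ℚ ↥E] (hE : ∀ x : L, τ x ∈ E), traceField Φ ≤ E →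
            ∀ L₀ : C5.OpenCompactSubgroup ↥(torusFinAdelic M),
              ∀ (K : C5.SmallLevel K₀) (R : AmbientReceptacle M Φ E hE L₀ Sc K),
                ImageStable M E L₀ Sc K R.A R.ι → Nonempty (LevelForm M Φ E hE L₀ Sc K R)

/-- **S3c — RECIPROCITY (62) HOLDS IN THE `E`-STRUCTURE OF THE LEVEL FORM** (through `e⁻¹`): (62) through `ι = e⁻¹ ≫ j_ℂ` (field
`reciprocity` of the receptacle, S4) and injectivity of `j` on complex points.  PROVED below (`pointAction_holds`).
[cite: Milne2005ShimuraVarieties, Def. 12.8 (62) p. 114, §13 p. 117] -/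
def PointAction : Prop :=
  ∀ (L : Type) [Field L] [NumberField L] [IsCMField L] (H : Matrix (Fin 3) (Fin 3) L) (τ : L →+* ℂ)
    (T : GL (Fin 3) ℂ) (hT : formCongr (starRingEnd ℂ) T (H.map τ) = BallModel.J),
    (∀ τ' : L →+* ℂ, InfinitePlace.mk τ' ≠ InfinitePlace.mk τ → (H.map τ').PosDef) →
    (∀ v : Fin 3 → L, ShimuraVarieties.hermForm (cmConjRingHom L) H v v = 0 → v = 0) →
    ∀ K₀ : C5.OpenCompactSubgroup ↥(finAdelic (↥(maximalRealSubfield L)) L (IsCMField.complexConj L) 3 H),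
      (∀ g : finAdelic (↥(maximalRealSubfield L)) L (IsCMField.complexConj L) 3 H,
        ∀ γ ∈ arithmeticLevel (↥(maximalRealSubfield L)) L (IsCMField.complexConj L) 3 H
          (K₀.1.map (MulAut.conj g).toMonoidHom), IsOfFinOrder γ → γ = 1) →
        ∀ (Sc : ComplexRecordSystem L H τ T hT K₀) (M : Type) [Field M] [NumberField M] [IsCMField M] (j : L →+* M)
          (Φ : CMType M), IsExtAdapted τ j Φ →
          ∀ (E : IntermediateField ℚ ℂ) [FiniteDimensional ℚ ↥E] (hE : ∀ x : L, τ x ∈ E), traceField Φ ≤ E →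
            ∀ L₀ : C5.OpenCompactSubgroup ↥(torusFinAdelic M),
              ∀ (K : C5.SmallLevel K₀) (R : AmbientReceptacle M Φ E hE L₀ Sc K) (F : LevelForm M Φ E hE L₀ Sc K R),
                ReciprocityThrough M Φ E hE L₀ Sc K F.N F.e.inv

/-- **S3b-1 — THE TRANSITION MAPS DESCEND** ([Deligne 1971] Variante 5.9; [Milne 2005] Thm. 13.7 (b)): for `f : K ⟶ K'` and level forms at
`K` and `K'` through which (62) holds, the complex transition map `e_K ≫ Sh(f)_ℂ ≫ e_{K'}⁻¹ : N_K ⊗ ℂ → N_{K'} ⊗ ℂ` is the base change of an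
`E`-morphism `N_K ⟶ N_{K'}` (unique, `Motives.baseChange ↥E ℂ` being faithful): it commutes with `Aut(ℂ/E)` on the dense diagonal special pairs
(★ `Aux.map_complexSystemExt_map_summandPointExt` + (62) at both levels with the SAME `s, d, t, x₀`), so [Milne 2005] Prop. 13.1 in dense form
applies = leaf (T1) `GaloisDescent.existsUnique_map_eq_of_dense_complex` (A-p13 g9; reducedness of `N_K ⊗ ℂ ≅ ∐ Sc.Mc_K` from smoothness,
separatedness of `N_{K'}` by descent of projectivity ★ `IsProjectiveOver.baseChange_iff` + ★ `isProjectiveOver_of_isColimit_cofan` +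
★ `Aux.finite_classGroup_printed_holds`).  Why it might fail: only through a mis-typed density/equivariance hypothesis of (T1) (the printed
statement is Milne's Thm. 13.7 (b)).  [cite: Milne2005ShimuraVarieties, Prop. 13.1 p. 117, Thm. 13.7 (b) p. 120] [cite: Deligne1971TravauxShimura, Variante 5.9 p. 157] -/
def TransitionDescends : Prop :=
  ∀ (L : Type) [Field L] [NumberField L] [IsCMField L] (H : Matrix (Fin 3) (Fin 3) L) (τ : L →+* ℂ)
    (T : GL (Fin 3) ℂ) (hT : formCongr (starRingEnd ℂ) T (H.map τ) = BallModel.J),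
    (∀ τ' : L →+* ℂ, InfinitePlace.mk τ' ≠ InfinitePlace.mk τ → (H.map τ').PosDef) →
    (∀ v : Fin 3 → L, ShimuraVarieties.hermForm (cmConjRingHom L) H v v = 0 → v = 0) →
    ∀ K₀ : C5.OpenCompactSubgroup ↥(finAdelic (↥(maximalRealSubfield L)) L (IsCMField.complexConj L) 3 H),
      (∀ g : finAdelic (↥(maximalRealSubfield L)) L (IsCMField.complexConj L) 3 H,
        ∀ γ ∈ arithmeticLevel (↥(maximalRealSubfield L)) L (IsCMField.complexConj L) 3 H
          (K₀.1.map (MulAut.conj g).toMonoidHom), IsOfFinOrder γ → γ = 1) →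
        ∀ (Sc : ComplexRecordSystem L H τ T hT K₀) (M : Type) [Field M] [NumberField M] [IsCMField M] (j : L →+* M)
          (Φ : CMType M), IsExtAdapted τ j Φ →
          ∀ (E : IntermediateField ℚ ℂ) [FiniteDimensional ℚ ↥E] (hE : ∀ x : L, τ x ∈ E), traceField Φ ≤ E →
            ∀ L₀ : C5.OpenCompactSubgroup ↥(torusFinAdelic M),
              ∀ (K K' : C5.SmallLevel K₀) (f : K ⟶ K') (R : AmbientReceptacle M Φ E hE L₀ Sc K) (R' : AmbientReceptacle M Φ E hE L₀ Sc K')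
                (F : LevelForm M Φ E hE L₀ Sc K R) (F' : LevelForm M Φ E hE L₀ Sc K' R'),
                ReciprocityThrough M Φ E hE L₀ Sc K F.N F.e.inv → ReciprocityThrough M Φ E hE L₀ Sc K' F'.N F'.e.inv →
                  ∃ m : F.N ⟶ F'.N,
                    (Motives.baseChange ↥E ℂ).map m = F.e.hom ≫ (complexSystemExt M Sc L₀).map f ≫ F'.e.inv

/-- **S3b-2 — THE CLASS-GROUP TRANSLATIONS DESCEND** (same move for `translMorExt K c`, ★ `Aux.map_translMorExt_summandPointExt`; the class
group is commutative, so `c · (t · p) = t · (c · p)` and the translation commutes with the Galois rule `(p, a) ↦ (t·p, d·a)` on special pairs).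
[cite: Milne2005ShimuraVarieties, Thm. 13.7 (b) p. 120; (33) p. 58] [cite: Deligne1971TravauxShimura, Variante 5.9 p. 157] -/
def TranslationDescends : Prop :=
  ∀ (L : Type) [Field L] [NumberField L] [IsCMField L] (H : Matrix (Fin 3) (Fin 3) L) (τ : L →+* ℂ)
    (T : GL (Fin 3) ℂ) (hT : formCongr (starRingEnd ℂ) T (H.map τ) = BallModel.J),
    (∀ τ' : L →+* ℂ, InfinitePlace.mk τ' ≠ InfinitePlace.mk τ → (H.map τ').PosDef) →
    (∀ v : Fin 3 → L, ShimuraVarieties.hermForm (cmConjRingHom L) H v v = 0 → v = 0) →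
    ∀ K₀ : C5.OpenCompactSubgroup ↥(finAdelic (↥(maximalRealSubfield L)) L (IsCMField.complexConj L) 3 H),
      (∀ g : finAdelic (↥(maximalRealSubfield L)) L (IsCMField.complexConj L) 3 H,
        ∀ γ ∈ arithmeticLevel (↥(maximalRealSubfield L)) L (IsCMField.complexConj L) 3 H
          (K₀.1.map (MulAut.conj g).toMonoidHom), IsOfFinOrder γ → γ = 1) →
        ∀ (Sc : ComplexRecordSystem L H τ T hT K₀) (M : Type) [Field M] [NumberField M] [IsCMField M] (j : L →+* M)
          (Φ : CMType M), IsExtAdapted τ j Φ →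
          ∀ (E : IntermediateField ℚ ℂ) [FiniteDimensional ℚ ↥E] (hE : ∀ x : L, τ x ∈ E), traceField Φ ≤ E →
            ∀ L₀ : C5.OpenCompactSubgroup ↥(torusFinAdelic M),
              ∀ (K : C5.SmallLevel K₀) (R : AmbientReceptacle M Φ E hE L₀ Sc K) (F : LevelForm M Φ E hE L₀ Sc K R),
                ReciprocityThrough M Φ E hE L₀ Sc K F.N F.e.inv →
                  ∀ c : classGroup M L₀, ∃ r : F.N ⟶ F.N,
                    (Motives.baseChange ↥E ℂ).map r = F.e.hom ≫ translMorExt M Sc L₀ K c ≫ F.e.inv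

/-- **S3a PROVED** — `LevelFormExists` from B-p06 ★ p625501 (effective descent of an `Aut(ℂ/E)`-stable reduced closed subscheme along `ℂ/E`,
`E` countable), the stability of the RANGE of `ι` on ALL scheme points being obtained from `ImageStable` (complex points) by (G1) + (Z1) +
continuity/closedness exactly as in §3 (4).  [cite: Deligne1971TravauxShimura, Cor. 5.7 p. 156] [cite: Milne2005ShimuraVarieties, Prop. 13.1 p. 117] -/
theorem levelFormExists_of_leaves (hZ1 : LeafZ1) (hG1 : LeafG1) : LevelFormExists := by
  intro L _ _ _ H τ T hT hpos hanis K₀ htf Sc M _ _ _ j Φ hΦ E _ hE hΦE L₀ K R hst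
  haveI : NumberField ↥E := NumberField.mk
  haveI : IsClosedImmersion R.ι.left := R.isClosedImmersion
  let Y : SchemeOver ℂ := (complexSystemExt M Sc L₀).obj K
  haveI : SmoothOfRelativeDimension 2 Y.hom :=
    smoothOfRelativeDimension_of_isColimit_cofan (coproductIsCoproduct fun _ : classGroup M L₀ => Sc.Mc.obj K)
      fun _ => Sc.smooth K
  haveI : Smooth Y.hom := SmoothOfRelativeDimension.smooth 2 _
  haveI : IsReduced Y.left := isReduced_of_smooth_over_field Y.hom
  have hK : Cardinal.mk ↥E ≤ Cardinal.aleph0 := by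
    refine (Algebra.IsAlgebraic.cardinalMk_le_max ℚ ↥E).trans ?_
    rw [Cardinal.mkRat, max_self]
  let ιb : ↥Y.left → ↥(GaloisDescent.bc ℂ R.A) := fun y => R.ι.left y
  have hιb : Continuous ιb := R.ι.left.continuous
  have hC : IsClosed (Set.range ιb) := R.ι.left.isClosedEmbedding.isClosed_range
  let SU : Set (ComplexPoints Y) := Set.univ
  have hZ : Dense (AlgPoints.pt '' SU : Set ↥Y.left) := hZ1 Y SU dense_univ
  have h1 : Set.range ιb ⊆ closure (ιb '' (AlgPoints.pt '' SU)) := by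
    rintro _ ⟨y, rfl⟩
    have hy : y ∈ closure (AlgPoints.pt '' SU) := by
      rw [hZ.closure_eq]
      exact Set.mem_univ y
    exact image_closure_subset_closure_image hιb ⟨y, hy, rfl⟩
  have hst' : ∀ σ : ℂ ≃ₐ[↥E] ℂ, ⇑(GaloisDescent.gal ℂ R.A σ) '' Set.range ⇑R.ι.left ⊆ Set.range ⇑R.ι.left := by
    intro σ
    let g : ↥(GaloisDescent.bc ℂ R.A) → ↥(GaloisDescent.bc ℂ R.A) := fun y => GaloisDescent.gal ℂ R.A σ y
    have hg : Continuous g := (GaloisDescent.gal ℂ R.A σ).continuous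
    have hgal : ∀ P' : ComplexPoints R.A, (pointsOfForm R.A (σ • P')).pt = g ((pointsOfForm R.A P').pt) :=
      fun P' => hG1 (↥E) (algebraMap ↥E ℂ) R.A σ P'
    have h2 : g '' (ιb '' (AlgPoints.pt '' SU)) ⊆ Set.range ιb := by
      rintro _ ⟨_, ⟨_, ⟨P, -, rfl⟩, rfl⟩, rfl⟩
      obtain ⟨Q, hQ⟩ := hst σ P
      refine ⟨Q.pt, ?_⟩
      have e1 := hgal ((pointsOfForm R.A).symm (AlgPoints.map R.ι P))
      rw [hQ, Equiv.apply_symm_apply, Equiv.apply_symm_apply] at e1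
      exact e1
    have h3 : g '' Set.range ιb ⊆ Set.range ιb := by
      refine (Set.image_mono h1).trans ?_
      exact (image_closure_subset_closure_image hg).trans ((closure_mono h2).trans hC.closure_eq.subset)
    exact h3
  obtain ⟨Z, jZ, hjZ, eZ, hfac⟩ :=
    @GaloisDescent.exists_iso_bcFunctor_map_eq_of_isReduced_of_image_subset_complex (↥E) _ _ R.A hK Y R.ι
      R.isClosedImmersion inferInstance hst'
  exact ⟨{ N := Z, j := jZ, isClosedImmersion := hjZ, e := eZ.symm, fac := hfac }⟩

/-- **S3c PROVED** — `PointAction`: rewrite `ι = e⁻¹ ≫ j_ℂ` in the receptacle's (62) and cancel the monomorphism `j`.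
[cite: Milne2005ShimuraVarieties, Def. 12.8 (62) p. 114] -/
theorem pointAction_holds : PointAction := by
  intro L _ _ _ H τ T hT hpos hanis K₀ htf Sc M _ _ _ j Φ hΦ E _ hE hΦE L₀ K R F
  haveI : IsClosedImmersion F.j.left := F.isClosedImmersion
  have h : ReciprocityThrough M Φ E hE L₀ Sc K R.A (F.e.inv ≫ (Motives.baseChange ↥E ℂ).map F.j) := by
    rw [F.fac]
    exact R.reciprocity
  exact reciprocityThrough_of_comp M Φ E hE L₀ Sc K F.j F.e.inv h


end S3SecondLayer

end Summit.HodgeConjecture.CorCM.HypDel.ExtReceptacle
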